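import Literature.MathematicalPhysics.QuantumLattice.HubbardEffectiveActionCTSpinCharge
import Literature.MathematicalPhysics.QuantumLattice.GrassmannLinearSubstitution
import HarnessLib

/-!
# Spin rotations `ψ̂^c_{k,σ} ↦ Σ_τ R_{τσ} ψ̂^c_{k,τ}` (`Rᵀ R = 1`) are symmetries of the countertermed Hubbard effective action
# (no pair seed): BGM 2006 §2.1 symmetry (3), global `SO(2)`/`SU(2)` spin rotations

Topic `MathematicalPhysics/QuantumLattice`; companion of `HubbardEffectiveActionCTSpinCharge.lean` (the diagonal, spin-resolved
`U(1)`), `HubbardEffectiveActionCTSpinFlip.lean` (the Weyl element) and `GrassmannLinearSubstitution.lean` (covariance of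
`effAction` / kernels under an ARBITRARY linear substitution of the generators, `effAction_map`, `kernel_map`).  For a
`2 × 2` matrix `R` the substitution matrix on the Hubbard labels is written inline (no definition):
`S A X = [k_A = k_X] [c_A = c_X] R_{σ_A σ_X}` (`Matrix.of …`), inducing `ψ̂^c_{k,σ} ↦ Σ_τ R_{τσ} ψ̂^c_{k,τ}` on BOTH charges
(`map_spinRot_psiPlus/psiMinus`) — for a real orthogonal `R` this is the Nambu-compatible form of the `SU(2)` rotation about the
`y`-axis; together with the spin-resolved `U(1)` of the companion file it generates all of `SU(2)`.

## Main statements (all proved; no definitions)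

* `sum_spinRotMatrix_mul` — the collapse `Σ_A S(A,X) g(A) = Σ_τ R_{τ σ_X} g(k_X, τ, c_X)`;
* `hubbardTwoPointCT_mixed_spin`, **`hubbardCovAboveCT_spin_structure`** — at `h = 0`: `C^K_{>Λ}((k,σ,c),(k',σ',c')) =
  [σ = σ'] · C^K_{>Λ}((k,↑,c),(k',↑,c'))`;
* **`spinRotMatrix_congr_hubbardCovAboveCT`** — `Sᵀ C^K_{>Λ} S = C^K_{>Λ}` for `Rᵀ R = 1`;
* `hubbardInteraction_eq_sum_prod`, `spinMonomialSum_swap13/24`, **`map_spinRot_hubbardInteraction`** — the Hubbard vertex is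
  invariant for `Rᵀ R = 1` (the spin sums `A(τ₁τ₂τ₃τ₄) = Σ_k [cons] ψ̂⁺_{k₁τ₁}ψ̂⁻_{k₂τ₂}ψ̂⁺_{k₃τ₃}ψ̂⁻_{k₄τ₄}` are antisymmetric in
  `τ₁ ↔ τ₃` and in `τ₂ ↔ τ₄`, so `V ∘ S = (det R)² V`); `map_spinRot_counterQuadratic`, **`map_spinRot_hubbardInteractionCT`**;
* **`map_spinRot_hubbardEffectiveActionCT`** — `𝒢^K_Λ ∘ S = 𝒢^K_Λ` at `h = 0`;
* **`kernel_hubbardEffectiveActionCT_spinRot`** — the WARD IDENTITY in raw form: for every degree `m` and labels `X'`,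
  `F_m(X') = Σ_{τ : Fin m → Fin 2} (∏ᵢ R_{σ'ᵢ τᵢ}) F_m(X' with spins τ)`.

## Sources

G. Benfatto, A. Giuliani, V. Mastropietro, Ann. Henri Poincaré 7 (2006) 809, §2.1 symmetry (3) (global `SO(2)` spin rotations),
§2.3 (consequences for the kernels) [`BenfattoGiulianiMastropietro2006`]; F. A. Berezin, *The Method of Second Quantization* (1966),
Ch. I §3 (linear automorphisms of the Grassmann algebra) [`Berezin1966`].
-/

noncomputable section

namespace Literature.MathematicalPhysics.QuantumLattice

open Literature.Probability.LatticeModels GrassmannAlgebra Finset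

/-! ### The substitution matrix and its action on the generators -/

section Matrix

variable (L M : ℕ) [NeZero L] (R : Matrix (Fin 2) (Fin 2) ℂ)

/-- **Collapse of the substitution matrix**: `Σ_A S(A, X) g(A) = Σ_τ R_{τ σ_X} g((k_X, τ), c_X)`. [cite: BenfattoGiulianiMastropietro2006, §2.1 symmetry (3)] -/
theorem sum_spinRotMatrix_mul (X : HubbardFieldIdx L M) (g : HubbardFieldIdx L M → ℂ) :
    ∑ A, (Matrix.of fun A X : HubbardFieldIdx L M => if A.1.1 = X.1.1 then (if A.2 = X.2 then R A.1.2 X.1.2 else 0) else 0) A X * g A = ∑ τ : Fin 2, R τ X.1.2 * g ((X.1.1, τ), X.2) := by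
  rw [Fintype.sum_prod_type, Fintype.sum_prod_type, Finset.sum_comm]
  refine Finset.sum_congr rfl fun τ _ => ?_
  rw [Finset.sum_comm]
  simp only [Matrix.of_apply, ite_mul, zero_mul, Fintype.sum_ite_eq']

/-- The same collapse with the matrix entry on the right: `Σ_A g(A) S(A, X) = Σ_τ g((k_X, τ), c_X) R_{τ σ_X}`.
[cite: BenfattoGiulianiMastropietro2006, §2.1 symmetry (3)] -/
theorem sum_mul_spinRotMatrix (X : HubbardFieldIdx L M) (g : HubbardFieldIdx L M → ℂ) :
    ∑ A, g A * (Matrix.of fun A X : HubbardFieldIdx L M => if A.1.1 = X.1.1 then (if A.2 = X.2 then R A.1.2 X.1.2 else 0) else 0) A X = ∑ τ : Fin 2, g ((X.1.1, τ), X.2) * R τ X.1.2 := by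
  simp_rw [mul_comm (g _) _]
  exact sum_spinRotMatrix_mul L M R X g

/-- The substitution on `ψ̂⁺`: `ψ̂⁺_{k,σ} ↦ Σ_τ R_{τσ} ψ̂⁺_{k,τ}`. [cite: BenfattoGiulianiMastropietro2006, §2.1 symmetry (3)] -/
theorem map_spinRot_psiPlus (k : FreqMomentum L M) (s : Fin 2) :
    ExteriorAlgebra.map (Matrix.toLin' (Matrix.of fun A X : HubbardFieldIdx L M => if A.1.1 = X.1.1 then (if A.2 = X.2 then R A.1.2 X.1.2 else 0) else 0)) (psiPlus k s) = ∑ τ : Fin 2, R τ s • psiPlus k τ := by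
  rw [psiPlus, map_gen_eq_sum, LinearMap.toMatrix'_toLin']
  rw [Fintype.sum_prod_type, Fintype.sum_prod_type, Finset.sum_comm]
  refine Finset.sum_congr rfl fun τ _ => ?_
  rw [Finset.sum_comm]
  simp only [Matrix.of_apply, ite_smul, zero_smul, Fintype.sum_ite_eq', psiPlus]

/-- The substitution on `ψ̂⁻`: `ψ̂⁻_{k,σ} ↦ Σ_τ R_{τσ} ψ̂⁻_{k,τ}`. [cite: BenfattoGiulianiMastropietro2006, §2.1 symmetry (3)] -/
theorem map_spinRot_psiMinus (k : FreqMomentum L M) (s : Fin 2) :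
    ExteriorAlgebra.map (Matrix.toLin' (Matrix.of fun A X : HubbardFieldIdx L M => if A.1.1 = X.1.1 then (if A.2 = X.2 then R A.1.2 X.1.2 else 0) else 0)) (psiMinus k s) = ∑ τ : Fin 2, R τ s • psiMinus k τ := by
  rw [psiMinus, map_gen_eq_sum, LinearMap.toMatrix'_toLin']
  rw [Fintype.sum_prod_type, Fintype.sum_prod_type, Finset.sum_comm]
  refine Finset.sum_congr rfl fun τ _ => ?_
  rw [Finset.sum_comm]
  simp only [Matrix.of_apply, ite_smul, zero_smul, Fintype.sum_ite_eq', psiMinus]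

end Matrix

/-! ### The covariance at zero seed is spin diagonal and spin independent -/

section Covariance

variable (L M : ℕ) [NeZero L]

omit [NeZero L] in
/-- Mixed-spin entries of the seedless CT two-point table vanish. [cite: BenfattoGiulianiMastropietro2006, §2.1 symmetry (3)] -/
theorem hubbardTwoPointCT_mixed_spin (β μ : ℝ) (K : TrigPolyC4v) (k k' : FreqMomentum L M) {s s' : Fin 2} (hs : s ≠ s')
    (c c' : Fin 2) : hubbardTwoPointCT L M β μ 0 K ((k, s), c) ((k', s'), c') = 0 := by
  fin_cases s <;> fin_cases s'
  · exact absurd rfl hs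
  · fin_cases c <;> fin_cases c' <;> simp [hubbardTwoPointCT, toNambu, nambuTwoPointCT]
  · fin_cases c <;> fin_cases c' <;> simp [hubbardTwoPointCT, toNambu, nambuTwoPointCT]
  · exact absurd rfl hs

/-- **Spin structure of the seedless CT two-point table**: `⟨ψ_{(k,σ,c)} ψ_{(k',σ',c')}⟩ = [σ = σ'] ⟨ψ_{(k,↑,c)} ψ_{(k',↑,c')}⟩`.
[cite: BenfattoGiulianiMastropietro2006, §2.1 symmetry (3)] -/
theorem hubbardTwoPointCT_spin_structure (β μ : ℝ) (K : TrigPolyC4v) (k k' : FreqMomentum L M) (s s' c c' : Fin 2) :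
    hubbardTwoPointCT L M β μ 0 K ((k, s), c) ((k', s'), c') =
      if s = s' then hubbardTwoPointCT L M β μ 0 K ((k, 0), c) ((k', 0), c') else 0 := by
  by_cases hs : s = s'
  · subst hs
    rw [if_pos rfl]
    fin_cases s
    · rfl
    · exact hubbardTwoPointCT_spinFlip L M β μ K ((k, 0), c) ((k', 0), c')
  · rw [if_neg hs]
    exact hubbardTwoPointCT_mixed_spin L M β μ K k k' hs c c'

/-- **Spin structure of the seedless CT covariance above scale `Λ`**: `C^K_{>Λ}((k,σ,c),(k',σ',c')) = [σ = σ'] C^K_{>Λ}((k,↑,c),(k',↑,c'))`.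
[cite: BenfattoGiulianiMastropietro2006, §2.1 symmetry (3)] -/
theorem hubbardCovAboveCT_spin_structure (β μ : ℝ) (K : TrigPolyC4v) (Λ : ℝ) (k k' : FreqMomentum L M) (s s' c c' : Fin 2) :
    hubbardCovAboveCT L M β μ 0 K Λ ((k, s), c) ((k', s'), c') =
      if s = s' then hubbardCovAboveCT L M β μ 0 K Λ ((k, 0), c) ((k', 0), c') else 0 := by
  simp only [hubbardCovAboveCT, Matrix.of_apply, hubbardCovarianceCT, hubbardTwoPointCT_spin_structure L M β μ K k k' s s' c c']
  split_ifs <;> simp [momentumOf]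

variable (R : Matrix (Fin 2) (Fin 2) ℂ)

/-- **The seedless CT covariance above scale `Λ` is invariant by congruence under spin rotations**: `Sᵀ C^K_{>Λ} S = C^K_{>Λ}` for
`Rᵀ R = 1` (the symmetry (3) of the Gaussian integration). [cite: BenfattoGiulianiMastropietro2006, §2.1 symmetry (3)] -/
theorem spinRotMatrix_congr_hubbardCovAboveCT (hR : R.transpose * R = 1) (β μ : ℝ) (K : TrigPolyC4v) (Λ : ℝ) :
    ((Matrix.of fun A X : HubbardFieldIdx L M => if A.1.1 = X.1.1 then (if A.2 = X.2 then R A.1.2 X.1.2 else 0) else 0)).transpose * hubbardCovAboveCT L M β μ 0 K Λ * (Matrix.of fun A X : HubbardFieldIdx L M => if A.1.1 = X.1.1 then (if A.2 = X.2 then R A.1.2 X.1.2 else 0) else 0) = hubbardCovAboveCT L M β μ 0 K Λ := by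
  ext X Y
  obtain ⟨⟨k, s⟩, c⟩ := X
  obtain ⟨⟨k', s'⟩, c'⟩ := Y
  rw [Matrix.mul_apply]
  simp_rw [Matrix.mul_apply, Matrix.transpose_apply]
  rw [sum_mul_spinRotMatrix L M R]
  simp_rw [sum_spinRotMatrix_mul L M R]
  rw [Finset.sum_congr rfl fun τ' _ => by
    rw [Finset.sum_congr rfl fun τ _ => by rw [hubbardCovAboveCT_spin_structure L M β μ K Λ k k' τ τ' c c']]]
  -- `Σ_τ' (Σ_τ R τ s · [τ = τ'] C₀) R τ' s' = (Rᵀ R)_{s s'} C₀ = [s = s'] C₀`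
  simp only [mul_ite, mul_zero, Fintype.sum_ite_eq']
  have hRR : ∀ a b : Fin 2, ∑ τ, R τ a * R τ b = if a = b then 1 else 0 := by
    intro a b
    have := congrFun (congrFun hR a) b
    simpa [Matrix.mul_apply, Matrix.transpose_apply, Matrix.one_apply] using this
  calc ∑ τ', R τ' s * hubbardCovAboveCT L M β μ 0 K Λ ((k, 0), c) ((k', 0), c') * R τ' s'
      = (∑ τ', R τ' s * R τ' s') * hubbardCovAboveCT L M β μ 0 K Λ ((k, 0), c) ((k', 0), c') := by
        rw [Finset.sum_mul]; exact Finset.sum_congr rfl fun τ' _ => by ring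
    _ = if s = s' then hubbardCovAboveCT L M β μ 0 K Λ ((k, 0), c) ((k', 0), c') else 0 := by
        rw [hRR, ite_mul, one_mul, zero_mul]
    _ = hubbardCovAboveCT L M β μ 0 K Λ ((k, s), c) ((k', s'), c') := (hubbardCovAboveCT_spin_structure L M β μ K Λ k k' s s' c c').symm

end Covariance

/-! ### The Hubbard vertex is invariant under spin rotations -/

section Interaction

variable (L M : ℕ)

/-- Reordering a fourfold sum, first and third variables exchanged: `Σ_a Σ_b Σ_c Σ_d G a b c d = Σ_a Σ_b Σ_c Σ_d G c b a d`.
[cite: Berezin1966, Ch. I §3] -/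
theorem sum_four_swap13 {α : Type*} [Fintype α] {N : Type*} [AddCommMonoid N] (G : α → α → α → α → N) :
    ∑ a, ∑ b, ∑ c, ∑ d, G a b c d = ∑ a, ∑ b, ∑ c, ∑ d, G c b a d := by
  calc ∑ a, ∑ b, ∑ c, ∑ d, G a b c d = ∑ b, ∑ a, ∑ c, ∑ d, G a b c d := Finset.sum_comm
    _ = ∑ b, ∑ c, ∑ a, ∑ d, G a b c d := Finset.sum_congr rfl fun b _ => Finset.sum_comm
    _ = ∑ c, ∑ b, ∑ a, ∑ d, G a b c d := Finset.sum_comm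

/-- Reordering a fourfold sum, second and fourth variables exchanged: `Σ_a Σ_b Σ_c Σ_d G a b c d = Σ_a Σ_b Σ_c Σ_d G a d c b`.
[cite: Berezin1966, Ch. I §3] -/
theorem sum_four_swap24 {α : Type*} [Fintype α] {N : Type*} [AddCommMonoid N] (G : α → α → α → α → N) :
    ∑ a, ∑ b, ∑ c, ∑ d, G a b c d = ∑ a, ∑ b, ∑ c, ∑ d, G a d c b := by
  refine Finset.sum_congr rfl fun a _ => ?_
  calc ∑ b, ∑ c, ∑ d, G a b c d = ∑ c, ∑ b, ∑ d, G a b c d := Finset.sum_comm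
    _ = ∑ c, ∑ d, ∑ b, G a b c d := Finset.sum_congr rfl fun c _ => Finset.sum_comm
    _ = ∑ d, ∑ c, ∑ b, G a b c d := Finset.sum_comm

/-- Three generators in reversed order: `ψ_X ψ_Y ψ_Z = −ψ_Z ψ_Y ψ_X`. [cite: Berezin1966, Ch. I §3] -/
theorem gen_mul_gen_mul_gen_rev (X Y Z : HubbardFieldIdx L M) :
    gen ℂ X * gen ℂ Y * gen ℂ Z = -(gen ℂ Z * gen ℂ Y * gen ℂ X) := by
  calc gen ℂ X * gen ℂ Y * gen ℂ Z = gen ℂ X * (gen ℂ Y * gen ℂ Z) := mul_assoc _ _ _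
    _ = gen ℂ X * (-(gen ℂ Z * gen ℂ Y)) := by rw [gen_mul_gen (R := ℂ) Y Z]
    _ = -((gen ℂ X * gen ℂ Z) * gen ℂ Y) := by rw [mul_neg, mul_assoc]
    _ = -(-(gen ℂ Z * gen ℂ X) * gen ℂ Y) := by rw [gen_mul_gen (R := ℂ) X Z]
    _ = gen ℂ Z * (gen ℂ X * gen ℂ Y) := by rw [neg_mul, neg_neg, mul_assoc]
    _ = gen ℂ Z * (-(gen ℂ Y * gen ℂ X)) := by rw [gen_mul_gen (R := ℂ) X Y]
    _ = -(gen ℂ Z * gen ℂ Y * gen ℂ X) := by rw [mul_neg, mul_assoc]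

/-- Exchanging the two `ψ̂⁺` legs of a Hubbard-type monomial costs a sign:
`ψ̂⁺_{k₁a} ψ̂⁻_{k₂b} ψ̂⁺_{k₃c} ψ̂⁻_{k₄d} = −ψ̂⁺_{k₃c} ψ̂⁻_{k₂b} ψ̂⁺_{k₁a} ψ̂⁻_{k₄d}`. [cite: Berezin1966, Ch. I §3] -/
theorem hubbardMonomial_swap13 (k₁ k₂ k₃ k₄ : FreqMomentum L M) (a b c d : Fin 2) :
    psiPlus k₁ a * psiMinus k₂ b * psiPlus k₃ c * psiMinus k₄ d = -(psiPlus k₃ c * psiMinus k₂ b * psiPlus k₁ a * psiMinus k₄ d) := by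
  simp only [psiPlus, psiMinus]
  rw [gen_mul_gen_mul_gen_rev L M ((k₁, a), 0) ((k₂, b), 1) ((k₃, c), 0), neg_mul]

/-- Exchanging the two `ψ̂⁻` legs of a Hubbard-type monomial costs a sign:
`ψ̂⁺_{k₁a} ψ̂⁻_{k₂b} ψ̂⁺_{k₃c} ψ̂⁻_{k₄d} = −ψ̂⁺_{k₁a} ψ̂⁻_{k₄d} ψ̂⁺_{k₃c} ψ̂⁻_{k₂b}`. [cite: Berezin1966, Ch. I §3] -/
theorem hubbardMonomial_swap24 (k₁ k₂ k₃ k₄ : FreqMomentum L M) (a b c d : Fin 2) :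
    psiPlus k₁ a * psiMinus k₂ b * psiPlus k₃ c * psiMinus k₄ d = -(psiPlus k₁ a * psiMinus k₄ d * psiPlus k₃ c * psiMinus k₂ b) := by
  simp only [psiPlus, psiMinus]
  rw [mul_assoc, mul_assoc, ← mul_assoc (gen ℂ ((k₂, b), (1 : Fin 2))),
    gen_mul_gen_mul_gen_rev L M ((k₂, b), 1) ((k₃, c), 0) ((k₄, d), 1)]
  simp only [mul_neg, mul_assoc]

variable [NeZero L]

/-- **The spin-resolved Hubbard monomial sums are antisymmetric under the exchange of the two `ψ̂⁺` spins**: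
`A(c,b,a,d) = −A(a,b,c,d)`, `A(τ₁τ₂τ₃τ₄) := Σ_k [cons] ψ̂⁺_{k₁τ₁}ψ̂⁻_{k₂τ₂}ψ̂⁺_{k₃τ₃}ψ̂⁻_{k₄τ₄}` (momentum conservation is symmetric
under `k₁ ↔ k₃`). [cite: BenfattoGiulianiMastropietro2006, §2.1 symmetry (3)] -/
theorem spinMonomialSum_swap13 (a b c d : Fin 2) :
    (∑ k₁ : FreqMomentum L M, ∑ k₂ : FreqMomentum L M, ∑ k₃ : FreqMomentum L M, ∑ k₄ : FreqMomentum L M,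
      if (matsubaraInt M k₁.1 + matsubaraInt M k₃.1 = matsubaraInt M k₂.1 + matsubaraInt M k₄.1 ∧ k₁.2 + k₃.2 = k₂.2 + k₄.2) then psiPlus k₁ c * psiMinus k₂ b * psiPlus k₃ a * psiMinus k₄ d else 0) =
    -(∑ k₁ : FreqMomentum L M, ∑ k₂ : FreqMomentum L M, ∑ k₃ : FreqMomentum L M, ∑ k₄ : FreqMomentum L M,
      if (matsubaraInt M k₁.1 + matsubaraInt M k₃.1 = matsubaraInt M k₂.1 + matsubaraInt M k₄.1 ∧ k₁.2 + k₃.2 = k₂.2 + k₄.2) then psiPlus k₁ a * psiMinus k₂ b * psiPlus k₃ c * psiMinus k₄ d else 0) := by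
  rw [sum_four_swap13]
  simp only [← Finset.sum_neg_distrib]
  refine Finset.sum_congr rfl fun k₁ _ => Finset.sum_congr rfl fun k₂ _ => Finset.sum_congr rfl fun k₃ _ =>
    Finset.sum_congr rfl fun k₄ _ => ?_
  have hcond : (matsubaraInt M k₃.1 + matsubaraInt M k₁.1 = matsubaraInt M k₂.1 + matsubaraInt M k₄.1 ∧ k₃.2 + k₁.2 = k₂.2 + k₄.2) ↔ (matsubaraInt M k₁.1 + matsubaraInt M k₃.1 = matsubaraInt M k₂.1 + matsubaraInt M k₄.1 ∧ k₁.2 + k₃.2 = k₂.2 + k₄.2) := by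
    rw [add_comm (matsubaraInt M k₃.1), add_comm k₃.2]
  simp only [hcond]
  split_ifs
  · rw [hubbardMonomial_swap13 L M k₃ k₂ k₁ k₄ c b a d]
  · rw [neg_zero]

/-- **… and under the exchange of the two `ψ̂⁻` spins**: `A(a,d,c,b) = −A(a,b,c,d)`. [cite: BenfattoGiulianiMastropietro2006, §2.1 symmetry (3)] -/
theorem spinMonomialSum_swap24 (a b c d : Fin 2) :
    (∑ k₁ : FreqMomentum L M, ∑ k₂ : FreqMomentum L M, ∑ k₃ : FreqMomentum L M, ∑ k₄ : FreqMomentum L M,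
      if (matsubaraInt M k₁.1 + matsubaraInt M k₃.1 = matsubaraInt M k₂.1 + matsubaraInt M k₄.1 ∧ k₁.2 + k₃.2 = k₂.2 + k₄.2) then psiPlus k₁ a * psiMinus k₂ d * psiPlus k₃ c * psiMinus k₄ b else 0) =
    -(∑ k₁ : FreqMomentum L M, ∑ k₂ : FreqMomentum L M, ∑ k₃ : FreqMomentum L M, ∑ k₄ : FreqMomentum L M,
      if (matsubaraInt M k₁.1 + matsubaraInt M k₃.1 = matsubaraInt M k₂.1 + matsubaraInt M k₄.1 ∧ k₁.2 + k₃.2 = k₂.2 + k₄.2) then psiPlus k₁ a * psiMinus k₂ b * psiPlus k₃ c * psiMinus k₄ d else 0) := by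
  rw [sum_four_swap24]
  simp only [← Finset.sum_neg_distrib]
  refine Finset.sum_congr rfl fun k₁ _ => Finset.sum_congr rfl fun k₂ _ => Finset.sum_congr rfl fun k₃ _ =>
    Finset.sum_congr rfl fun k₄ _ => ?_
  have hcond : (matsubaraInt M k₁.1 + matsubaraInt M k₃.1 = matsubaraInt M k₄.1 + matsubaraInt M k₂.1 ∧ k₁.2 + k₃.2 = k₄.2 + k₂.2) ↔ (matsubaraInt M k₁.1 + matsubaraInt M k₃.1 = matsubaraInt M k₂.1 + matsubaraInt M k₄.1 ∧ k₁.2 + k₃.2 = k₂.2 + k₄.2) := by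
    rw [add_comm (matsubaraInt M k₄.1) (matsubaraInt M k₂.1), add_comm k₄.2 k₂.2]
  simp only [hcond]
  split_ifs
  · rw [hubbardMonomial_swap24 L M k₁ k₄ k₃ k₂ a d c b]
  · rw [neg_zero]

end Interaction

/-! ### Linearity of the conserved momentum sum and the rotated vertex -/

section Rotation

variable (L M : ℕ) [NeZero L]

/-- The conserved fourfold momentum sum is linear: `Σ_k [cons] Σ_τ c_τ m_τ(k) = Σ_τ c_τ Σ_k [cons] m_τ(k)`.
[cite: BenfattoGiulianiMastropietro2006, §2.1 symmetry (3)] -/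
theorem consSum_sum_smul {T : Type*} [Fintype T] (coef : T → ℂ)
    (m : T → FreqMomentum L M → FreqMomentum L M → FreqMomentum L M → FreqMomentum L M → HubbardGrassmann L M) :
    (∑ k₁ : FreqMomentum L M, ∑ k₂ : FreqMomentum L M, ∑ k₃ : FreqMomentum L M, ∑ k₄ : FreqMomentum L M,
      if (matsubaraInt M k₁.1 + matsubaraInt M k₃.1 = matsubaraInt M k₂.1 + matsubaraInt M k₄.1 ∧ k₁.2 + k₃.2 = k₂.2 + k₄.2) then ∑ τ, coef τ • m τ k₁ k₂ k₃ k₄ else 0) =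
    ∑ τ, coef τ • ∑ k₁ : FreqMomentum L M, ∑ k₂ : FreqMomentum L M, ∑ k₃ : FreqMomentum L M, ∑ k₄ : FreqMomentum L M,
      if (matsubaraInt M k₁.1 + matsubaraInt M k₃.1 = matsubaraInt M k₂.1 + matsubaraInt M k₄.1 ∧ k₁.2 + k₃.2 = k₂.2 + k₄.2) then m τ k₁ k₂ k₃ k₄ else 0 := by
  have hite : ∀ k₁ k₂ k₃ k₄ : FreqMomentum L M,
      (if (matsubaraInt M k₁.1 + matsubaraInt M k₃.1 = matsubaraInt M k₂.1 + matsubaraInt M k₄.1 ∧ k₁.2 + k₃.2 = k₂.2 + k₄.2) then ∑ τ, coef τ • m τ k₁ k₂ k₃ k₄ else 0) = ∑ τ, if (matsubaraInt M k₁.1 + matsubaraInt M k₃.1 = matsubaraInt M k₂.1 + matsubaraInt M k₄.1 ∧ k₁.2 + k₃.2 = k₂.2 + k₄.2) then coef τ • m τ k₁ k₂ k₃ k₄ else 0 := by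
    intro k₁ k₂ k₃ k₄
    split_ifs <;> simp
  simp only [hite, Finset.smul_sum, smul_ite, smul_zero]
  rw [Finset.sum_congr rfl fun k₁ _ => Finset.sum_congr rfl fun k₂ _ => Finset.sum_congr rfl fun k₃ _ => Finset.sum_comm]
  rw [Finset.sum_congr rfl fun k₁ _ => Finset.sum_congr rfl fun k₂ _ => Finset.sum_comm]
  rw [Finset.sum_congr rfl fun k₁ _ => Finset.sum_comm]
  rw [Finset.sum_comm]

variable (R : Matrix (Fin 2) (Fin 2) ℂ)

/-- **The rotated Hubbard monomial**: `S(ψ̂⁺_{k₁↑}ψ̂⁻_{k₂↑}ψ̂⁺_{k₃↓}ψ̂⁻_{k₄↓}) = Σ_{τ} R_{τ₁↑}R_{τ₂↑}R_{τ₃↓}R_{τ₄↓} ψ̂⁺_{k₁τ₁}ψ̂⁻_{k₂τ₂}ψ̂⁺_{k₃τ₃}ψ̂⁻_{k₄τ₄}`.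
[cite: BenfattoGiulianiMastropietro2006, §2.1 symmetry (3)] -/
theorem map_spinRot_hubbardMonomial (k₁ k₂ k₃ k₄ : FreqMomentum L M) :
    ExteriorAlgebra.map (Matrix.toLin' (Matrix.of fun A X : HubbardFieldIdx L M => if A.1.1 = X.1.1 then (if A.2 = X.2 then R A.1.2 X.1.2 else 0) else 0)) (psiPlus k₁ 0 * psiMinus k₂ 0 * psiPlus k₃ 1 * psiMinus k₄ 1) =
      ∑ τ : Fin 2 × Fin 2 × Fin 2 × Fin 2,
        (R τ.1 0 * R τ.2.1 0 * R τ.2.2.1 1 * R τ.2.2.2 1) •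
          (psiPlus k₁ τ.1 * psiMinus k₂ τ.2.1 * psiPlus k₃ τ.2.2.1 * psiMinus k₄ τ.2.2.2) := by
  rw [map_mul, map_mul, map_mul, map_spinRot_psiPlus, map_spinRot_psiMinus, map_spinRot_psiPlus, map_spinRot_psiMinus]
  simp only [Fintype.sum_prod_type, Fin.sum_univ_two, Fin.isValue, mul_add, add_mul, Algebra.smul_mul_assoc,
    Algebra.mul_smul_comm]
  module

/-- **The Hubbard vertex is invariant under spin rotations**: `V ∘ S = V` for `Rᵀ R = 1` — only the four spin patterns
`↑↑↓↓, ↓↓↑↑, ↑↓↓↑, ↓↑↑↓` of the conserved sums survive (antisymmetry under the exchange of the two `ψ̂⁺` or the two `ψ̂⁻` legs)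
and their coefficients add up to `(det R)² = 1` (BGM 2006 §2.1, symmetry (3)). [cite: BenfattoGiulianiMastropietro2006, §2.1 symmetry (3)] -/
theorem map_spinRot_hubbardInteraction (hR : R.transpose * R = 1) (β U : ℝ) :
    ExteriorAlgebra.map (Matrix.toLin' (Matrix.of fun A X : HubbardFieldIdx L M => if A.1.1 = X.1.1 then (if A.2 = X.2 then R A.1.2 X.1.2 else 0) else 0)) (hubbardInteraction L M β U) = hubbardInteraction L M β U := by
  -- `(det R)² = 1`
  have hdet : (R 0 0 * R 1 1 - R 0 1 * R 1 0) ^ 2 = 1 := by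
    have h := congrArg Matrix.det hR
    rw [Matrix.det_mul, Matrix.det_transpose, Matrix.det_one, Matrix.det_fin_two] at h
    rw [sq]
    exact h
  -- the spin sums `A a b c d`
  set A : Fin 2 → Fin 2 → Fin 2 → Fin 2 → HubbardGrassmann L M := fun a b c d =>
    ∑ k₁ : FreqMomentum L M, ∑ k₂ : FreqMomentum L M, ∑ k₃ : FreqMomentum L M, ∑ k₄ : FreqMomentum L M,
      if (matsubaraInt M k₁.1 + matsubaraInt M k₃.1 = matsubaraInt M k₂.1 + matsubaraInt M k₄.1 ∧ k₁.2 + k₃.2 = k₂.2 + k₄.2) then psiPlus k₁ a * psiMinus k₂ b * psiPlus k₃ c * psiMinus k₄ d else 0 with hA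
  have h13 : ∀ a b c d, A c b a d = -A a b c d := fun a b c d => spinMonomialSum_swap13 L M a b c d
  have h24 : ∀ a b c d, A a d c b = -A a b c d := fun a b c d => spinMonomialSum_swap24 L M a b c d
  have hvan13 : ∀ a b d, A a b a d = 0 := by
    intro a b d
    have h := h13 a b a d
    have h2 : (2 : ℂ) • A a b a d = 0 := by rw [two_smul]; nth_rw 1 [h]; exact neg_add_cancel _
    exact (smul_eq_zero.mp h2).resolve_left two_ne_zero
  have hvan24 : ∀ a b c, A a b c b = 0 := by
    intro a b c
    have h := h24 a b c b
    have h2 : (2 : ℂ) • A a b c b = 0 := by rw [two_smul]; nth_rw 1 [h]; exact neg_add_cancel _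
    exact (smul_eq_zero.mp h2).resolve_left two_ne_zero
  have hV : hubbardInteraction L M β U = ((U / (β * (L : ℝ) ^ 2) ^ 3 : ℝ) : ℂ) • A 0 0 1 1 := rfl
  -- the rotated vertex: `S(A ↑↑↓↓) = Σ_τ coef τ • A τ`
  have hmapA : ExteriorAlgebra.map (Matrix.toLin' (Matrix.of fun A X : HubbardFieldIdx L M => if A.1.1 = X.1.1 then (if A.2 = X.2 then R A.1.2 X.1.2 else 0) else 0)) (A 0 0 1 1) =
      ∑ τ : Fin 2 × Fin 2 × Fin 2 × Fin 2, (R τ.1 0 * R τ.2.1 0 * R τ.2.2.1 1 * R τ.2.2.2 1) • A τ.1 τ.2.1 τ.2.2.1 τ.2.2.2 := by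
    have hite : ∀ k₁ k₂ k₃ k₄ : FreqMomentum L M,
        ExteriorAlgebra.map (Matrix.toLin' (Matrix.of fun A X : HubbardFieldIdx L M => if A.1.1 = X.1.1 then (if A.2 = X.2 then R A.1.2 X.1.2 else 0) else 0))
            (if (matsubaraInt M k₁.1 + matsubaraInt M k₃.1 = matsubaraInt M k₂.1 + matsubaraInt M k₄.1 ∧ k₁.2 + k₃.2 = k₂.2 + k₄.2) then psiPlus k₁ 0 * psiMinus k₂ 0 * psiPlus k₃ 1 * psiMinus k₄ 1 else 0) =
          if (matsubaraInt M k₁.1 + matsubaraInt M k₃.1 = matsubaraInt M k₂.1 + matsubaraInt M k₄.1 ∧ k₁.2 + k₃.2 = k₂.2 + k₄.2) then ∑ τ : Fin 2 × Fin 2 × Fin 2 × Fin 2,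
            (R τ.1 0 * R τ.2.1 0 * R τ.2.2.1 1 * R τ.2.2.2 1) •
              (psiPlus k₁ τ.1 * psiMinus k₂ τ.2.1 * psiPlus k₃ τ.2.2.1 * psiMinus k₄ τ.2.2.2) else 0 := by
      intro k₁ k₂ k₃ k₄
      split_ifs
      · exact map_spinRot_hubbardMonomial L M R k₁ k₂ k₃ k₄
      · exact map_zero _
    simp only [hA, map_sum, hite]
    exact consSum_sum_smul L M (fun τ : Fin 2 × Fin 2 × Fin 2 × Fin 2 => R τ.1 0 * R τ.2.1 0 * R τ.2.2.1 1 * R τ.2.2.2 1)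
      (fun τ k₁ k₂ k₃ k₄ => psiPlus k₁ τ.1 * psiMinus k₂ τ.2.1 * psiPlus k₃ τ.2.2.1 * psiMinus k₄ τ.2.2.2)
  rw [hV, map_smul, hmapA]
  congr 1
  -- sixteen spin patterns; twelve vanish, four are `± A ↑↑↓↓`
  simp only [Fintype.sum_prod_type, Fin.sum_univ_two, Fin.isValue]
  have e0110 : A 0 1 1 0 = -A 0 0 1 1 := by rw [← h24 0 0 1 1]
  have e1001 : A 1 0 0 1 = -A 0 0 1 1 := by rw [← h13 0 0 1 1]
  have e1100 : A 1 1 0 0 = A 0 0 1 1 := by rw [h13 0 1 1 0, e0110, neg_neg]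
  rw [hvan13 0 0 0, hvan13 0 0 1, hvan13 0 1 0, hvan13 0 1 1, hvan13 1 0 0, hvan13 1 0 1, hvan13 1 1 0, hvan13 1 1 1,
    hvan24 0 0 1, hvan24 0 1 1, hvan24 1 0 0, hvan24 1 1 0, e0110, e1001, e1100]
  calc _ = ((R 0 0 * R 1 1 - R 0 1 * R 1 0) ^ 2) • A 0 0 1 1 := by module
    _ = A 0 0 1 1 := by rw [hdet, one_smul]

end Rotation

/-! ### The counterterm, the effective action and the kernels -/

section Action

variable (L M : ℕ) [NeZero L] (R : Matrix (Fin 2) (Fin 2) ℂ)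

/-- **The counterterm vertex is invariant under spin rotations**: `𝒩_K ∘ S = 𝒩_K` (`Σ_σ ψ̂⁺_{kσ}ψ̂⁻_{kσ}` is a rotation scalar;
uses `R Rᵀ = 1`, equivalent to `Rᵀ R = 1` for square `R`). [cite: BenfattoGiulianiMastropietro2006, §2.1 symmetry (3)] -/
theorem map_spinRot_counterQuadratic (hR : R.transpose * R = 1) (β : ℝ) (K : TrigPolyC4v) :
    ExteriorAlgebra.map (Matrix.toLin' (Matrix.of fun A X : HubbardFieldIdx L M => if A.1.1 = X.1.1 then (if A.2 = X.2 then R A.1.2 X.1.2 else 0) else 0)) (counterQuadratic L M β K) = counterQuadratic L M β K := by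
  have hR' : R * R.transpose = 1 := mul_eq_one_comm.mp hR
  have h00 : R 0 0 * R 0 0 + R 0 1 * R 0 1 = 1 := by
    have := congrFun (congrFun hR' 0) 0
    simpa [Matrix.mul_apply, Matrix.transpose_apply, Fin.sum_univ_two, Matrix.one_apply] using this
  have h11 : R 1 0 * R 1 0 + R 1 1 * R 1 1 = 1 := by
    have := congrFun (congrFun hR' 1) 1
    simpa [Matrix.mul_apply, Matrix.transpose_apply, Fin.sum_univ_two, Matrix.one_apply] using this
  have h01 : R 0 0 * R 1 0 + R 0 1 * R 1 1 = 0 := by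
    have := congrFun (congrFun hR' 0) 1
    simpa [Matrix.mul_apply, Matrix.transpose_apply, Fin.sum_univ_two, Matrix.one_apply] using this
  rw [counterQuadratic, map_sum]
  refine Finset.sum_congr rfl fun k _ => ?_
  set c : ℂ := ((K.eval (latticeMomentum L k.2) / (β * (L : ℝ) ^ 2) : ℝ) : ℂ) with hc
  rw [map_sum]
  simp only [map_smul, map_mul, map_spinRot_psiPlus, map_spinRot_psiMinus, Fin.sum_univ_two, Fin.isValue, mul_add,
    add_mul, Algebra.smul_mul_assoc, Algebra.mul_smul_comm, smul_smul, smul_add]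
  match_scalars <;>
    first
    | linear_combination c * h00
    | linear_combination c * h01
    | linear_combination c * h11

/-- **The interaction slot `V_K` is invariant under spin rotations.** [cite: BenfattoGiulianiMastropietro2006, §2.1 symmetry (3)] -/
theorem map_spinRot_hubbardInteractionCT (hR : R.transpose * R = 1) (β U : ℝ) (K : TrigPolyC4v) :
    ExteriorAlgebra.map (Matrix.toLin' (Matrix.of fun A X : HubbardFieldIdx L M => if A.1.1 = X.1.1 then (if A.2 = X.2 then R A.1.2 X.1.2 else 0) else 0)) (hubbardInteractionCT L M β U K) = hubbardInteractionCT L M β U K := by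
  rw [hubbardInteractionCT, map_add, map_spinRot_hubbardInteraction L M R hR, map_spinRot_counterQuadratic L M R hR]

/-- **Spin rotations are symmetries of the seedless countertermed effective action**: `𝒢^K_Λ ∘ S = 𝒢^K_Λ` at `h = 0` for every
`R` with `Rᵀ R = 1`, frame `K` and scale `Λ` (covariance invariant by congruence, interaction invariant, `effAction` covariant —
`GrassmannLinearSubstitution.effAction_map`). [cite: BenfattoGiulianiMastropietro2006, §2.1 symmetry (3)] -/
theorem map_spinRot_hubbardEffectiveActionCT (hR : R.transpose * R = 1) (β U μ : ℝ) (K : TrigPolyC4v) (Λ : ℝ) :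
    ExteriorAlgebra.map (Matrix.toLin' (Matrix.of fun A X : HubbardFieldIdx L M => if A.1.1 = X.1.1 then (if A.2 = X.2 then R A.1.2 X.1.2 else 0) else 0)) (hubbardEffectiveActionCT L M β U μ 0 K Λ) = hubbardEffectiveActionCT L M β U μ 0 K Λ := by
  have h := effAction_map ℂ (Matrix.toLin' (Matrix.of fun A X : HubbardFieldIdx L M => if A.1.1 = X.1.1 then (if A.2 = X.2 then R A.1.2 X.1.2 else 0) else 0)) (hubbardCovAboveCT L M β μ 0 K Λ) (hubbardInteractionCT L M β U K)
  rw [LinearMap.toMatrix'_toLin', spinRotMatrix_congr_hubbardCovAboveCT L M R hR, map_spinRot_hubbardInteractionCT L M R hR] at h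
  rw [hubbardEffectiveActionCT]
  exact h.symm

/-- **Collapse of the tensor power of the substitution matrix**: for labels `X'`,
`Σ_{X} (∏ᵢ S(X'ᵢ, Xᵢ)) g(X) = Σ_{τ : Fin m → Fin 2} (∏ᵢ R_{σ'ᵢ τᵢ}) g(X' with spins τ)`. [cite: BenfattoGiulianiMastropietro2006, §2.1 symmetry (3)] -/
theorem sum_prod_spinRotMatrix {m : ℕ} (X' : Fin m → HubbardFieldIdx L M) (g : (Fin m → HubbardFieldIdx L M) → ℂ) :
    ∑ X : Fin m → HubbardFieldIdx L M, (∏ i, (Matrix.of fun A X : HubbardFieldIdx L M => if A.1.1 = X.1.1 then (if A.2 = X.2 then R A.1.2 X.1.2 else 0) else 0) (X' i) (X i)) * g X =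
      ∑ τ : Fin m → Fin 2, (∏ i, R (X' i).1.2 (τ i)) * g (fun i => (((X' i).1.1, τ i), (X' i).2)) := by
  classical
  set ι : (Fin m → Fin 2) → (Fin m → HubbardFieldIdx L M) := fun τ i => (((X' i).1.1, τ i), (X' i).2) with hι
  have hinj : Function.Injective ι := by
    intro τ τ' h
    funext i
    have hi := congrFun h i
    simp only [hι, Prod.mk.injEq] at hi
    exact hi.1.2
  have hval : ∀ τ : Fin m → Fin 2, (∏ i, (Matrix.of fun A X : HubbardFieldIdx L M => if A.1.1 = X.1.1 then (if A.2 = X.2 then R A.1.2 X.1.2 else 0) else 0) (X' i) (ι τ i)) = ∏ i, R (X' i).1.2 (τ i) := by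
    intro τ
    refine Finset.prod_congr rfl fun i _ => ?_
    simp [hι, Matrix.of_apply]
  symm
  calc ∑ τ : Fin m → Fin 2, (∏ i, R (X' i).1.2 (τ i)) * g (fun i => (((X' i).1.1, τ i), (X' i).2))
      = ∑ τ : Fin m → Fin 2, ((∏ i, (Matrix.of fun A X : HubbardFieldIdx L M => if A.1.1 = X.1.1 then (if A.2 = X.2 then R A.1.2 X.1.2 else 0) else 0) (X' i) (ι τ i)) * g (ι τ)) := by
        refine Finset.sum_congr rfl fun τ _ => ?_
        rw [hval]
    _ = ∑ X ∈ (Finset.univ : Finset (Fin m → Fin 2)).image ι, (∏ i, (Matrix.of fun A X : HubbardFieldIdx L M => if A.1.1 = X.1.1 then (if A.2 = X.2 then R A.1.2 X.1.2 else 0) else 0) (X' i) (X i)) * g X :=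
        (Finset.sum_image (f := fun X : Fin m → HubbardFieldIdx L M => (∏ i, (Matrix.of fun A X : HubbardFieldIdx L M => if A.1.1 = X.1.1 then (if A.2 = X.2 then R A.1.2 X.1.2 else 0) else 0) (X' i) (X i)) * g X)
          fun τ _ τ' _ h => hinj h).symm
    _ = ∑ X : Fin m → HubbardFieldIdx L M, (∏ i, (Matrix.of fun A X : HubbardFieldIdx L M => if A.1.1 = X.1.1 then (if A.2 = X.2 then R A.1.2 X.1.2 else 0) else 0) (X' i) (X i)) * g X := by
        refine Finset.sum_subset (Finset.subset_univ _) fun X _ hX => ?_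
        -- off the image some factor of the product vanishes
        have hex : ∃ i, ¬ ((X' i).1.1 = (X i).1.1 ∧ (X' i).2 = (X i).2) := by
          by_contra hall
          push Not at hall
          apply hX
          refine Finset.mem_image.2 ⟨fun i => (X i).1.2, Finset.mem_univ _, ?_⟩
          funext i
          obtain ⟨h1, h2⟩ := hall i
          simp only [hι]
          ext <;> simp [h1, h2]
        obtain ⟨i, hi⟩ := hex
        rw [Finset.prod_eq_zero (Finset.mem_univ i), zero_mul]
        simp only [Matrix.of_apply]
        by_cases h1 : (X' i).1.1 = (X i).1.1
        · rw [if_pos h1, if_neg (fun h2 => hi ⟨h1, h2⟩)]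
        · rw [if_neg h1]

/-- **The Ward identity of the spin rotations, raw form**: for every degree `m`, labels `X'` and every `R` with `Rᵀ R = 1`,
`F_m(X') = Σ_{τ : Fin m → Fin 2} (∏ᵢ R_{σ'ᵢ τᵢ}) · F_m(X' with spins τ)` — the kernels of `𝒢^K_Λ` (`h = 0`) are invariant tensors
of the rotation. [cite: BenfattoGiulianiMastropietro2006, §2.3] -/
theorem kernel_hubbardEffectiveActionCT_spinRot (hR : R.transpose * R = 1) (β U μ : ℝ) (K : TrigPolyC4v) (Λ : ℝ) {m : ℕ}
    (X' : Fin m → HubbardFieldIdx L M) :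
    kernel ℂ (hubbardEffectiveActionCT L M β U μ 0 K Λ) m X' =
      ∑ τ : Fin m → Fin 2, (∏ i, R (X' i).1.2 (τ i)) *
        kernel ℂ (hubbardEffectiveActionCT L M β U μ 0 K Λ) m (fun i => (((X' i).1.1, τ i), (X' i).2)) := by
  conv_lhs => rw [← map_spinRot_hubbardEffectiveActionCT L M R hR β U μ K Λ]
  rw [kernel_map, LinearMap.toMatrix'_toLin', sum_prod_spinRotMatrix]

end Action

end Literature.MathematicalPhysics.QuantumLattice
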